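import Literature.Computability.Learning.LearnerCoinsBij
import Literature.Computability.Learning.LearnerWindows
import HarnessLib

/-!
# The success analysis of the CIKK learner (counting over the coins)

Analysis instalment (M9a-3) of the decomposition of the named fact
`Literature.Computability.Learning.cikk_natural_implies_learning` (CIKK 2016, Thm. 5.1). Fix
`n, a, b`, the target `f`, the property `R` and a GOOD LEVEL `ℓg`; the coin length is
`coinLen n a b ℓg = lvlCoff n a b (ℓg + 1)` (so that exactly the levels `ℓ ≤ ℓg` are processed).
For coins `rv : Fin (coinLen …) → Bool`:

* `GoodRun ℓ ρ rv` — the hypothesis of run `ρ` of level `ℓ` has error `≤ 2ⁿ/(2a)`;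
  `BadV ℓ ρ rv` — its validation is misleading; `Success rv` — the output is a candidate with
  error `≤ 2ⁿ/a`;
* `success_of` — a good run at level `ℓg` and no misleading validation force success;
* `card_noGood_le` — `#{rv | no good run at ℓg} ≤ (1 - p₀)^{Reps} · 2^{coinLen}` (independent
  windows + `card_goodRun_ge`); `card_badV_le` — `#{rv | BadV ℓ ρ rv} ≤ 2 e^{-m/(8a²)} · 2^{coinLen}`
  (fibres + Hoeffding); `card_not_success_le` — the union bound.

## References

* M. Carmosino, R. Impagliazzo, V. Kabanets, A. Kolokolova, *Learning algorithms from natural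
  proofs*, CCC 2016, §5 and Thm. 5.1 [CarmosinoImpagliazzoKabanetsKolokolova2016].
* W. Hoeffding, *Probability inequalities for sums of bounded random variables*, JASA 58 (1963),
  Thm. 1 [Hoeffding1963].
-/

namespace Literature.Computability.Learning

open Literature.Computability.Complexity Literature.Computability.Complexity.DirectProduct
  Literature.Computability.MetaComplexity Literature.Computability.Cryptography _root_.Computability Finset

section Setup

variable (n a b : ℕ)

/-- **The coin length for the good level `ℓg`**: all blocks of the levels `≤ ℓg`. [folklore] -/
def coinLen (ℓg : ℕ) : ℕ := lvlCoff n a b (ℓg + 1)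

variable {n a b}

/-- `lvlBlockLen ≥ 1`. [folklore] -/
theorem one_le_lvlBlockLen (ℓ : ℕ) : 1 ≤ lvlBlockLen n a b ℓ := by
  rw [lvlBlockLen, lvlRunLen, runLen, offSt, offA, offPb, offSg, offSd, offW]
  have h1 : 1 ≤ prmReps (prmS n a b) ℓ := Nat.one_le_two_pow
  have h2 := prmKK_ge (prmS n a b) ℓ
  calc 1 ≤ 1 * 28 := by norm_num
    _ ≤ prmReps (prmS n a b) ℓ * (ℓ + lvlQ n a b ℓ * lvlQ n a b ℓ + 2 ^ ℓ + prmKK (prmS n a b) ℓ * lvlK n a b ℓ +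
        prmKK (prmS n a b) ℓ + lvlK n a b ℓ + lvlK n a b ℓ * n +
        prmT (prmS n a b) ℓ * stepLen n (lvlK n a b ℓ) (prmKappa (prmS n a b) ℓ)) :=
        Nat.mul_le_mul h1 (by generalize 2 ^ ℓ = L; omega)
    _ ≤ _ := Nat.le_add_right _ _

/-- `lvlCoff` is strictly monotone. [folklore] -/
theorem lvlCoff_lt_succ (ℓ : ℕ) : lvlCoff n a b ℓ < lvlCoff n a b (ℓ + 1) := by
  rw [lvlCoff, lvlCoff, Finset.sum_range_succ]; have := one_le_lvlBlockLen (n := n) (a := a) (b := b) ℓ; omega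

/-- `lvlCoff` is monotone. [folklore] -/
theorem lvlCoff_mono {ℓ ℓ' : ℕ} (h : ℓ ≤ ℓ') : lvlCoff n a b ℓ ≤ lvlCoff n a b ℓ' :=
  Finset.sum_le_sum_of_subset (Finset.range_mono h)

/-- **With `coinLen ℓg` coins exactly the levels `ℓ ≤ ℓg` are processed.** [folklore] -/
theorem processed_iff (ℓg ℓ : ℕ) : LvlProcessed n a b (coinLen n a b ℓg) ℓ ↔ ℓ ≤ ℓg := by
  rw [LvlProcessed, coinLen]
  constructor
  · intro h
    by_contra hc
    have := lvlCoff_mono (n := n) (a := a) (b := b) (show ℓg + 1 + 1 ≤ ℓ + 1 by omega)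
    have := lvlCoff_lt_succ (n := n) (a := a) (b := b) (ℓg + 1)
    omega
  · intro h; exact lvlCoff_mono (by omega)

variable (n a b) (f : (Fin n → Bool) → Bool) (R : CombinatorialProperty) (ℓg : ℕ)

/-- The coins as a list. [folklore] -/
abbrev coinsList (rv : Fin (coinLen n a b ℓg) → Bool) : List Bool := List.ofFn rv

/-- The number of disagreement points of a hypothesis with `f`. [folklore] -/
def errCount (h : (Fin n → Bool) → Bool) : ℕ := (univ.filter fun x => h x ≠ f x).card

/-- **A good run**: error `≤ 2ⁿ/(2a)`. [cite: CarmosinoImpagliazzoKabanetsKolokolova2016, Thm. 5.1 (proof)] -/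
def GoodRun (ℓ ρ : ℕ) (rv : Fin (coinLen n a b ℓg) → Bool) : Prop :=
  2 * a * errCount n f (hypOf R n a b (coinsList n a b ℓg rv) f ℓ ρ) ≤ 2 ^ n

/-- **A misleading validation**: a bad candidate passes or a good one fails. [folklore] -/
def BadV (ℓ ρ : ℕ) (rv : Fin (coinLen n a b ℓg) → Bool) : Prop :=
  (2 ^ n < a * errCount n f (hypOf R n a b (coinsList n a b ℓg rv) f ℓ ρ) ∧ Passes R n a b (coinsList n a b ℓg rv) f ℓ ρ) ∨
    (GoodRun n a b f R ℓg ℓ ρ rv ∧ ¬ Passes R n a b (coinsList n a b ℓg rv) f ℓ ρ)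

/-- **Success**: the output is a candidate of error `≤ 2ⁿ/a`. [folklore] -/
def Success (rv : Fin (coinLen n a b ℓg) → Bool) : Prop :=
  ∃ ℓ ρ, gfnOut R n a b (coinsList n a b ℓg rv) f = candStr n a b (coinsList n a b ℓg rv) f ℓ ρ ∧
    a * errCount n f (hypOf R n a b (coinsList n a b ℓg rv) f ℓ ρ) ≤ 2 ^ n

variable {n a b f R ℓg}

/-- The length of the coins list. [folklore] -/
@[simp] theorem length_coinsList (rv : Fin (coinLen n a b ℓg) → Bool) : (coinsList n a b ℓg rv).length = coinLen n a b ℓg := by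
  simp [coinsList]

/-- **The logic of the selection**: a good run at the good level and no misleading validation
force success. [cite: CarmosinoImpagliazzoKabanetsKolokolova2016, §5 (complete algorithm, step 6)] -/
theorem success_of (rv : Fin (coinLen n a b ℓg) → Bool) (hgood : ∃ ρ < prmReps (prmS n a b) ℓg, GoodRun n a b f R ℓg ℓg ρ rv)
    (hval : ∀ ℓ ≤ ℓg, ∀ ρ < prmReps (prmS n a b) ℓ, ¬ BadV n a b f R ℓg ℓ ρ rv) : Success n a b f R ℓg rv := by
  classical
  set r := coinsList n a b ℓg rv with hr
  have hlen : r.length = coinLen n a b ℓg := length_coinsList rv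
  -- the good level has a nonempty selection
  obtain ⟨ρ₀, hρ₀, hg₀⟩ := hgood
  have hpass₀ : Passes R n a b r f ℓg ρ₀ := by
    by_contra hnp; exact hval ℓg le_rfl ρ₀ hρ₀ (Or.inr ⟨hg₀, hnp⟩)
  have hproc : LvlProcessed n a b r.length ℓg := by rw [hlen]; exact (processed_iff ℓg ℓg).2 le_rfl
  have hsome₀ : ((List.range (prmReps (prmS n a b) ℓg)).find? fun ρ => decide (Passes R n a b r f ℓg ρ)).isSome := by
    rw [List.find?_isSome]; exact ⟨ρ₀, List.mem_range.2 hρ₀, by simpa using hpass₀⟩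
  have hne : levelSelOut R n a b r f ℓg ≠ [] := by
    rw [levelSelOut, if_pos hproc]
    rcases hq : (List.range (prmReps (prmS n a b) ℓg)).find? (fun ρ => decide (Passes R n a b r f ℓg ρ)) with _ | ρ
    · rw [hq] at hsome₀; exact absurd hsome₀ (by simp)
    · exact candStr_ne_nil ℓg ρ
  -- so the global search succeeds
  have hℓgC : ℓg < r.length + 1 := by have := lt_length_of_processed hproc; omega
  have hsomeG : ((List.range (r.length + 1)).find? fun ℓ => decide (levelSelOut R n a b r f ℓ ≠ [])).isSome := by
    rw [List.find?_isSome]; exact ⟨ℓg, List.mem_range.2 hℓgC, by simpa using hne⟩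
  rcases hq : (List.range (r.length + 1)).find? (fun ℓ => decide (levelSelOut R n a b r f ℓ ≠ [])) with _ | ℓ₁
  · rw [hq] at hsomeG; exact absurd hsomeG (by simp)
  have hℓ₁ : levelSelOut R n a b r f ℓ₁ ≠ [] := by simpa using List.find?_some hq
  have hproc₁ : LvlProcessed n a b r.length ℓ₁ := by
    by_contra hnp; rw [levelSelOut, if_neg hnp] at hℓ₁; exact hℓ₁ rfl
  have hle₁ : ℓ₁ ≤ ℓg := (processed_iff ℓg ℓ₁).1 (by rwa [hlen] at hproc₁)
  rcases hq₁ : (List.range (prmReps (prmS n a b) ℓ₁)).find? (fun ρ => decide (Passes R n a b r f ℓ₁ ρ)) with _ | ρ₁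
  · rw [levelSelOut, if_pos hproc₁, hq₁] at hℓ₁; exact absurd rfl hℓ₁
  have hpass₁ : Passes R n a b r f ℓ₁ ρ₁ := by simpa using List.find?_some hq₁
  have hρ₁ : ρ₁ < prmReps (prmS n a b) ℓ₁ := List.mem_range.1 (List.mem_of_find?_eq_some hq₁)
  refine ⟨ℓ₁, ρ₁, ?_, ?_⟩
  · rw [gfnOut, hq, Option.elim_some, levelSelOut, if_pos hproc₁, hq₁, Option.elim_some]
  · have := hval ℓ₁ hle₁ ρ₁ hρ₁
    rw [BadV, not_or, not_and] at this
    exact not_lt.1 fun hlt => this.1 hlt hpass₁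

end Setup
/-! ### Windows of the coins: run segments -/

section WindowFacts

variable {n a b : ℕ} {f : (Fin n → Bool) → Bool} {R : CombinatorialProperty} {ℓg : ℕ}

/-- The run segment `(ℓ, ρ)` fits into the coins (`ℓ ≤ ℓg`, `ρ < Reps`). [folklore] -/
theorem segWindow_le {ℓ : ℕ} (hℓ : ℓ ≤ ℓg) {ρ : ℕ} (hρ : ρ < prmReps (prmS n a b) ℓ) :
    lvlCoff n a b ℓ + ρ * lvlRunLen n a b ℓ + lvlRunLen n a b ℓ ≤ coinLen n a b ℓg :=
  seg_fits (r := List.replicate (coinLen n a b ℓg) false) (by rw [List.length_replicate]; exact (processed_iff ℓg ℓ).2 hℓ) hρ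
    |>.trans (by rw [List.length_replicate])

/-- The hypothesis of a run read off a window assignment. [folklore] -/
noncomputable def runHypW (n a b : ℕ) (f : (Fin n → Bool) → Bool) (R : CombinatorialProperty) (ℓ : ℕ)
    (w : Fin (lvlRunLen n a b ℓ) → Bool) : (Fin n → Bool) → Bool :=
  runHyp (learnerDesign (lvlQ n a b ℓ) n (lvlK n a b ℓ) ℓ (lvl_hn n a b ℓ)) (natTest R ℓ) f
    (coinsToRun n (lvlK n a b ℓ) ℓ (prmKK (prmS n a b) ℓ) (prmT (prmS n a b) ℓ) (lvlQ n a b ℓ) (prmKappa (prmS n a b) ℓ)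
      (lvlK_pos n a b ℓ) (List.ofFn w))

omit R in
/-- A slice of `List.ofFn` is the `ofFn` of the window. [folklore] -/
theorem slice_ofFn_eq {C o len : ℕ} (h : o + len ≤ C) (rv : Fin C → Bool) :
    slice (List.ofFn rv) o len = List.ofFn (windowRead h rv) := by
  rw [slice_eq_ofFn (by simpa using h)]
  refine congrArg List.ofFn (funext fun i => ?_)
  rw [readBits, List.getD_eq_getElem _ _ (by simp; omega), List.getElem_ofFn, windowRead]

/-- **The hypothesis of run `(ℓ, ρ)` depends only on its window.** [folklore] -/
theorem hypOf_eq_runHypW {ℓ : ℕ} (hℓ : ℓ ≤ ℓg) {ρ : ℕ} (hρ : ρ < prmReps (prmS n a b) ℓ) (rv : Fin (coinLen n a b ℓg) → Bool) :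
    hypOf R n a b (coinsList n a b ℓg rv) f ℓ ρ = runHypW n a b f R ℓ (windowRead (segWindow_le hℓ hρ) rv) := by
  rw [hypOf, runHypW, lvlCoins, lvlSeg, coinsList, slice_ofFn_eq (segWindow_le hℓ hρ)]

omit R in
/-- Outside its window a glued string does not depend on the window bits. [folklore] -/
theorem glue_apply_of_not_mem {C o len : ℕ} (h : o + len ≤ C) (rest : Fin (C - len) → Bool) (w w' : Fin len → Bool)
    (i : Fin C) (hi : (i : ℕ) < o ∨ o + len ≤ i) : glue h (rest, w) i = glue h (rest, w') i := by
  rcases hi with hi | hi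
  · simp [glue, hi]
  · simp only [glue, dif_neg (show ¬ (i : ℕ) < o by omega), dif_neg (show ¬ (i : ℕ) < o + len by omega)]

omit R in
/-- **Disjoint windows**: reading a window disjoint from the glued one does not see the glued bits.
[folklore] -/
theorem windowRead_glue_of_disjoint {C o len o' len' : ℕ} (h : o + len ≤ C) (h' : o' + len' ≤ C)
    (hdis : o' + len' ≤ o ∨ o + len ≤ o') (rest : Fin (C - len) → Bool) (w w' : Fin len → Bool) :
    windowRead h' (glue h (rest, w)) = windowRead h' (glue h (rest, w')) := by
  funext i
  simp only [windowRead]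
  have hi := i.isLt
  have key : o' + (i : ℕ) < o ∨ o + len ≤ o' + (i : ℕ) := by
    rcases hdis with hd | hd
    · left; omega
    · right; omega
  exact glue_apply_of_not_mem h rest w w' _ key

end WindowFacts

open scoped Classical

/-! ### No good run at the good level: independent windows -/

section NoGood

variable (n a b : ℕ) (f : (Fin n → Bool) → Bool) (R : CombinatorialProperty) (ℓg : ℕ)

/-- No run `ρ < m` of level `ℓg` is good. [folklore] -/
def NoGoodBelow (m : ℕ) (rv : Fin (coinLen n a b ℓg) → Bool) : Prop := ∀ ρ < m, ¬ GoodRun n a b f R ℓg ℓg ρ rv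

/-- A good window assignment of a run of level `ℓg`. [folklore] -/
def GoodW (w : Fin (lvlRunLen n a b ℓg) → Bool) : Prop := 2 * a * errCount n f (runHypW n a b f R ℓg w) ≤ 2 ^ n

variable {n a b f R ℓg}

/-- `GoodRun` at level `ℓg` is `GoodW` of the window. [folklore] -/
theorem goodRun_iff {ρ : ℕ} (hρ : ρ < prmReps (prmS n a b) ℓg) (rv : Fin (coinLen n a b ℓg) → Bool) :
    GoodRun n a b f R ℓg ℓg ρ rv ↔ GoodW n a b f R ℓg (windowRead (segWindow_le le_rfl hρ) rv) := by
  rw [GoodRun, GoodW, hypOf_eq_runHypW le_rfl hρ]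

/-- **The product identity**: `#{NoGoodBelow m} · (2^{RL})^m = 2^{coinLen} · #{¬GoodW}^m`. [cite: CarmosinoImpagliazzoKabanetsKolokolova2016, Thm. 5.1 (proof: independent repetitions)] -/
theorem card_noGoodBelow_mul : ∀ m : ℕ, m ≤ prmReps (prmS n a b) ℓg →
    (univ.filter (NoGoodBelow n a b f R ℓg m)).card * (2 ^ lvlRunLen n a b ℓg) ^ m =
      2 ^ coinLen n a b ℓg * (univ.filter fun w => ¬ GoodW n a b f R ℓg w).card ^ m
  | 0, _ => by
    rw [pow_zero, mul_one, pow_zero, mul_one,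
      Finset.filter_true_of_mem (s := univ) (p := NoGoodBelow n a b f R ℓg 0) (fun rv _ => fun ρ h => absurd h (Nat.not_lt_zero _)),
      Finset.card_univ, Fintype.card_fun, Fintype.card_fin, Fintype.card_bool]
  | m + 1, hm => by
    have hρ : m < prmReps (prmS n a b) ℓg := hm
    have hwin := segWindow_le (n := n) (a := a) (b := b) (le_refl ℓg) hρ
    -- `NoGoodBelow (m+1) = NoGoodBelow m ∧ ¬Good(window m)`
    have hsplit : (univ.filter (NoGoodBelow n a b f R ℓg (m + 1))) =
        univ.filter fun rv => NoGoodBelow n a b f R ℓg m rv ∧ ¬ GoodW n a b f R ℓg (windowRead hwin rv) := by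
      refine Finset.filter_congr fun rv _ => ?_
      rw [NoGoodBelow, NoGoodBelow]
      constructor
      · intro h; exact ⟨fun ρ hρ' => h ρ (by omega), fun hg => h m (Nat.lt_succ_self m) ((goodRun_iff hρ rv).2 hg)⟩
      · rintro ⟨h1, h2⟩ ρ hρ'
        rcases Nat.lt_succ_iff_lt_or_eq.1 hρ' with hlt | heq
        · exact h1 ρ hlt
        · rw [heq]; exact fun hg => h2 ((goodRun_iff hρ rv).1 hg)
    -- the earlier windows do not see window `m`
    have hind : ∀ rest w w', NoGoodBelow n a b f R ℓg m (glue hwin (rest, w)) ↔ NoGoodBelow n a b f R ℓg m (glue hwin (rest, w')) := by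
      intro rest w w'
      have key : ∀ ρ < m, (GoodRun n a b f R ℓg ℓg ρ (glue hwin (rest, w)) ↔ GoodRun n a b f R ℓg ℓg ρ (glue hwin (rest, w'))) := by
        intro ρ hρm
        have hρ' : ρ < prmReps (prmS n a b) ℓg := by omega
        have hdis : lvlCoff n a b ℓg + ρ * lvlRunLen n a b ℓg + lvlRunLen n a b ℓg ≤ lvlCoff n a b ℓg + m * lvlRunLen n a b ℓg := by
          have : (ρ + 1) * lvlRunLen n a b ℓg ≤ m * lvlRunLen n a b ℓg := Nat.mul_le_mul_right _ hρm
          rw [Nat.succ_mul] at this; omega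
        rw [goodRun_iff hρ', goodRun_iff hρ', windowRead_glue_of_disjoint hwin (segWindow_le le_rfl hρ') (Or.inl hdis)]
      simp only [NoGoodBelow]
      exact forall₂_congr fun ρ hρm => by rw [key ρ hρm]
    have hstep := card_filter_and_window hwin (NoGoodBelow n a b f R ℓg m) (fun w => ¬ GoodW n a b f R ℓg w) hind
    have ih := card_noGoodBelow_mul m (by omega)
    rw [hsplit, pow_succ, ← mul_assoc, mul_comm ((univ.filter fun rv => NoGoodBelow n a b f R ℓg m rv ∧ _).card),
      show (2 ^ lvlRunLen n a b ℓg) ^ m * (univ.filter fun rv => NoGoodBelow n a b f R ℓg m rv ∧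
          ¬GoodW n a b f R ℓg (windowRead hwin rv)).card * 2 ^ lvlRunLen n a b ℓg =
        (2 ^ lvlRunLen n a b ℓg) ^ m * ((univ.filter (NoGoodBelow n a b f R ℓg m)).card *
          (univ.filter fun w => ¬ GoodW n a b f R ℓg w).card) by rw [mul_assoc, hstep],
      ← mul_assoc, mul_comm ((2 ^ lvlRunLen n a b ℓg) ^ m), ih, pow_succ, mul_assoc]

/-- `¬GoodW` has at most `(1-p₀)·2^{RL}` elements if `GoodW` has at least `p₀·2^{RL}`. [folklore] -/
theorem card_not_goodW_le {p₀ : ℝ} (hp : p₀ * 2 ^ lvlRunLen n a b ℓg ≤ ((univ.filter (GoodW n a b f R ℓg)).card : ℝ)) :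
    ((univ.filter fun w => ¬ GoodW n a b f R ℓg w).card : ℝ) ≤ (1 - p₀) * 2 ^ lvlRunLen n a b ℓg := by
  have hsum := Finset.card_filter_add_card_filter_not (s := (univ : Finset (Fin (lvlRunLen n a b ℓg) → Bool))) (GoodW n a b f R ℓg)
  rw [Finset.card_univ, Fintype.card_fun, Fintype.card_fin, Fintype.card_bool] at hsum
  have hcast : ((univ.filter (GoodW n a b f R ℓg)).card : ℝ) + ((univ.filter fun w => ¬ GoodW n a b f R ℓg w).card : ℝ) =
      2 ^ lvlRunLen n a b ℓg := by exact_mod_cast hsum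
  linarith

/-- **No good run among the `Reps` runs of the good level is rare**:
`#{NoGoodBelow Reps} ≤ (1 - p₀)^{Reps} · 2^{coinLen}`. [cite: CarmosinoImpagliazzoKabanetsKolokolova2016, Thm. 5.1 (proof)] -/
theorem card_noGood_le {p₀ : ℝ}
    (hp : p₀ * 2 ^ lvlRunLen n a b ℓg ≤ ((univ.filter (GoodW n a b f R ℓg)).card : ℝ)) :
    ((univ.filter (NoGoodBelow n a b f R ℓg (prmReps (prmS n a b) ℓg))).card : ℝ) ≤
      (1 - p₀) ^ prmReps (prmS n a b) ℓg * 2 ^ coinLen n a b ℓg := by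
  have hid := card_noGoodBelow_mul (f := f) (R := R) (prmReps (prmS n a b) ℓg) le_rfl
  have hidR : ((univ.filter (NoGoodBelow n a b f R ℓg (prmReps (prmS n a b) ℓg))).card : ℝ) *
      ((2 : ℝ) ^ lvlRunLen n a b ℓg) ^ prmReps (prmS n a b) ℓg =
      2 ^ coinLen n a b ℓg * ((univ.filter fun w => ¬ GoodW n a b f R ℓg w).card : ℝ) ^ prmReps (prmS n a b) ℓg := by
    exact_mod_cast hid
  have hbad := card_not_goodW_le hp
  have hpos : (0 : ℝ) < ((2 : ℝ) ^ lvlRunLen n a b ℓg) ^ prmReps (prmS n a b) ℓg := pow_pos (pow_pos two_pos _) _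
  have hG0 : (0 : ℝ) ≤ ((univ.filter fun w => ¬ GoodW n a b f R ℓg w).card : ℝ) := Nat.cast_nonneg _
  have hpow := pow_le_pow_left₀ hG0 hbad (prmReps (prmS n a b) ℓg)
  refine le_of_mul_le_mul_right ?_ hpos
  calc ((univ.filter (NoGoodBelow n a b f R ℓg (prmReps (prmS n a b) ℓg))).card : ℝ) *
        ((2 : ℝ) ^ lvlRunLen n a b ℓg) ^ prmReps (prmS n a b) ℓg
      = 2 ^ coinLen n a b ℓg * ((univ.filter fun w => ¬ GoodW n a b f R ℓg w).card : ℝ) ^ prmReps (prmS n a b) ℓg := hidR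
    _ ≤ 2 ^ coinLen n a b ℓg * (((1 - p₀) * 2 ^ lvlRunLen n a b ℓg) ^ prmReps (prmS n a b) ℓg) :=
        mul_le_mul_of_nonneg_left hpow (pow_nonneg two_pos.le _)
    _ = (1 - p₀) ^ prmReps (prmS n a b) ℓg * 2 ^ coinLen n a b ℓg * ((2 : ℝ) ^ lvlRunLen n a b ℓg) ^ prmReps (prmS n a b) ℓg := by
        rw [mul_pow]; ring

/-- The one-run success probability constant `p₀ = η ε' (3ε'/16)(1 - 2e^{-k/8})` of
`card_goodRun_ge` at level `ℓ`. [cite: CarmosinoImpagliazzoKabanetsKolokolova2016, Thm. 5.1 (proof)] -/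
noncomputable def pZero (n a b ℓ : ℕ) : ℝ :=
  1 / (10 * (2 : ℝ) ^ ℓ) * (1 / (10 * (2 : ℝ) ^ ℓ) / (4 * 2 ^ prmKK (prmS n a b) ℓ)) *
    (3 * (1 / (10 * (2 : ℝ) ^ ℓ) / (4 * 2 ^ prmKK (prmS n a b) ℓ)) / 16 * (1 - 2 * Real.exp (-((lvlK n a b ℓ : ℝ) / 8))))

/-- **Good window assignments are abundant**: `p₀ · 2^{RL} ≤ #{w | GoodW w}` at the good level,
from `card_goodRun_ge` transported along the run-coin bijection.
[cite: CarmosinoImpagliazzoKabanetsKolokolova2016, Thm. 5.1 (proof)] -/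
theorem card_goodW_ge (ha : 1 ≤ a)
    (hadv : (1 / 5 : ℝ) ≤ advantage (natTest R ℓg)
      (nwGenerator (learnerDesign (lvlQ n a b ℓg) n (lvlK n a b ℓg) ℓg (lvl_hn n a b ℓg)) (ampFnFin f (lvlK n a b ℓg))))
    (hGL : (lvlK n a b ℓg : ℝ) ≤ 2 * (1 / (10 * (2 ^ ℓg : ℕ)) / 2) ^ 2 * (2 ^ prmKK (prmS n a b) ℓg - 1 : ℕ))
    (H1u : Real.exp (-(3 * (1 / (2 * a)) * lvlK n a b ℓg / 2048)) ≤
      (1 / (10 * (2 ^ ℓg : ℕ)) / (4 * 2 ^ prmKK (prmS n a b) ℓg)) ^ 2 * (1 / (2 * a)) / 4096)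
    (H2u : Real.exp (-(lvlK n a b ℓg * (1 / (2 * a)) ^ 2 / 2048)) ≤ 1 / (10 * (2 ^ ℓg : ℕ)) / (4 * 2 ^ prmKK (prmS n a b) ℓg) / 4)
    (H3u : Real.exp (-(prmT (prmS n a b) ℓg * (1 / (10 * (2 ^ ℓg : ℕ)) / (4 * 2 ^ prmKK (prmS n a b) ℓg)) / 32)) ≤ 1 / (2 * a) / 16) :
    pZero n a b ℓg * 2 ^ lvlRunLen n a b ℓg ≤ ((univ.filter (GoodW n a b f R ℓg)).card : ℝ) := by
  have ha' : (0 : ℝ) < a := by exact_mod_cast ha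
  have hδ : (0 : ℝ) < 1 / (2 * a) := by positivity
  have h := card_goodRun_ge (n := n) (m := lvlQ n a b ℓg * lvlQ n a b ℓg)
    (learnerDesign (lvlQ n a b ℓg) n (lvlK n a b ℓg) ℓg (lvl_hn n a b ℓg)) (natTest R ℓg) f
    (Nat.two_pow_pos ℓg) (lvlK_pos n a b ℓg) (lt_of_lt_of_le (by norm_num) (prmKK_ge (prmS n a b) ℓg)) hadv hδ hGL H1u H2u H3u
  rw [card_runCoins (n := n) (k := lvlK n a b ℓg) (ℓ := ℓg) (kk := prmKK (prmS n a b) ℓg) (t := prmT (prmS n a b) ℓg)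
    (q := lvlQ n a b ℓg) (κ := prmKappa (prmS n a b) ℓg) rfl] at h
  simp only [Nat.cast_pow, Nat.cast_ofNat] at h
  have hp : pZero n a b ℓg * 2 ^ lvlRunLen n a b ℓg =
      1 / (10 * (2 : ℝ) ^ ℓg) * (1 / (10 * (2 : ℝ) ^ ℓg) / (4 * 2 ^ prmKK (prmS n a b) ℓg)) *
        (3 * (1 / (10 * (2 : ℝ) ^ ℓg) / (4 * 2 ^ prmKK (prmS n a b) ℓg)) / 16 * (1 - 2 * Real.exp (-((lvlK n a b ℓg : ℝ) / 8)))) *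
        2 ^ runLen n (lvlK n a b ℓg) ℓg (prmKK (prmS n a b) ℓg) (prmT (prmS n a b) ℓg) (lvlQ n a b ℓg) (prmKappa (prmS n a b) ℓg) := by
    rw [pZero, lvlRunLen]
  rw [hp]
  refine h.trans (le_of_eq ?_)
  -- the good run coins are the good windows
  rw [← card_filter_seg_eq (n := n) (k := lvlK n a b ℓg) (ℓ := ℓg) (kk := prmKK (prmS n a b) ℓg) (t := prmT (prmS n a b) ℓg)
    (q := lvlQ n a b ℓg) (κ := prmKappa (prmS n a b) ℓg) rfl (lvlK_pos n a b ℓg)]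
  congr 1
  refine congrArg Finset.card (Finset.filter_congr fun w _ => ?_)
  rw [GoodW, runHypW, errCount, Fintype.card_fun, Fintype.card_fin, Fintype.card_bool, Nat.cast_pow, Nat.cast_two,
    show (1 / (2 * (a : ℝ))) * 2 ^ n = 2 ^ n / (2 * a) by ring, le_div_iff₀ (by positivity)]
  constructor
  · intro hle
    have : ((2 * a * (univ.filter fun x => runHyp (learnerDesign (lvlQ n a b ℓg) n (lvlK n a b ℓg) ℓg (lvl_hn n a b ℓg))
        (natTest R ℓg) f (coinsToRun n (lvlK n a b ℓg) ℓg (prmKK (prmS n a b) ℓg) (prmT (prmS n a b) ℓg) (lvlQ n a b ℓg)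
        (prmKappa (prmS n a b) ℓg) (lvlK_pos n a b ℓg) (List.ofFn w)) x ≠ f x).card : ℕ) : ℝ) ≤ ((2 ^ n : ℕ) : ℝ) := by
      push_cast; linarith
    exact_mod_cast this
  · intro hle
    have : (2 * a * (univ.filter fun x => runHyp (learnerDesign (lvlQ n a b ℓg) n (lvlK n a b ℓg) ℓg (lvl_hn n a b ℓg))
        (natTest R ℓg) f (coinsToRun n (lvlK n a b ℓg) ℓg (prmKK (prmS n a b) ℓg) (prmT (prmS n a b) ℓg) (lvlQ n a b ℓg)
        (prmKappa (prmS n a b) ℓg) (lvlK_pos n a b ℓg) (List.ofFn w)) x ≠ f x).card : ℕ) ≤ 2 ^ n := hle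
    have := (Nat.cast_le (α := ℝ)).2 this
    push_cast at this
    linarith

end NoGood

/-! ### Misleading validations: fibres and Hoeffding -/

section Validation

variable {n a b : ℕ} {f : (Fin n → Bool) → Bool} {R : CombinatorialProperty} {ℓg : ℕ}

/-- The validation window of level `ℓ ≤ ℓg` fits into the coins. [folklore] -/
theorem valWindow_le {ℓ : ℕ} (hℓ : ℓ ≤ ℓg) :
    lvlCoff n a b ℓ + prmReps (prmS n a b) ℓ * lvlRunLen n a b ℓ + prmM (prmS n a b) ℓ * n ≤ coinLen n a b ℓg := by
  have h := (processed_iff (n := n) (a := a) (b := b) ℓg ℓ).2 hℓ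
  rw [LvlProcessed, lvlCoff, Finset.sum_range_succ, ← lvlCoff, lvlBlockLen, ← Nat.add_assoc] at h
  exact h

/-- **The validation points are read off the validation window.** [folklore] -/
theorem lvlValPt_eq {ℓ : ℕ} (hℓ : ℓ ≤ ℓg) (rv : Fin (coinLen n a b ℓg) → Bool) {wv : ℕ} (hwv : wv < prmM (prmS n a b) ℓ) :
    lvlValPt n a b (coinsList n a b ℓg rv) ℓ wv = fun d : Fin n =>
      windowRead (valWindow_le hℓ) rv ⟨wv * n + d, by
        have : (wv + 1) * n ≤ prmM (prmS n a b) ℓ * n := Nat.mul_le_mul_right _ hwv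
        rw [Nat.succ_mul] at this; omega⟩ := by
  funext d
  have hfit : (wv + 1) * n ≤ prmM (prmS n a b) ℓ * n := Nat.mul_le_mul_right _ hwv
  rw [Nat.succ_mul] at hfit
  have hC := valWindow_le (n := n) (a := a) (b := b) hℓ
  rw [lvlValPt, readBits, coinsList, List.getD_eq_getElem _ _ (by simp; omega), List.getElem_ofFn, windowRead]
  congr 1
  exact Fin.ext (by dsimp only; ring)

/-- **The error count of a candidate on the validation sample** as a count over the window. [folklore] -/
theorem errsOf_eq {ℓ : ℕ} (hℓ : ℓ ≤ ℓg) (ρ : ℕ) (rv : Fin (coinLen n a b ℓg) → Bool) :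
    errsOf R n a b (coinsList n a b ℓg rv) f ℓ ρ =
      ((Finset.range (prmM (prmS n a b) ℓ)).filter fun wv =>
        if hwv : wv < prmM (prmS n a b) ℓ then
          hypOf R n a b (coinsList n a b ℓg rv) f ℓ ρ (fun d => windowRead (valWindow_le hℓ) rv ⟨wv * n + d, by
            have : (wv + 1) * n ≤ prmM (prmS n a b) ℓ * n := Nat.mul_le_mul_right _ hwv
            rw [Nat.succ_mul] at this; omega⟩) ≠
          f (fun d => windowRead (valWindow_le hℓ) rv ⟨wv * n + d, by
            have : (wv + 1) * n ≤ prmM (prmS n a b) ℓ * n := Nat.mul_le_mul_right _ hwv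
            rw [Nat.succ_mul] at this; omega⟩)
        else False).card := by
  rw [errsOf]
  refine congrArg Finset.card (Finset.filter_congr fun wv hwv => ?_)
  rw [Finset.mem_range] at hwv
  rw [dif_pos hwv, lvlValPt_eq hℓ rv hwv]

/-- `#` of a filtered `range` is `#` of the corresponding filter over `Fin`. [folklore] -/
theorem card_filter_range_dite (M : ℕ) (P : Fin M → Prop) [DecidablePred P] :
    ((Finset.range M).filter fun wv => if h : wv < M then P ⟨wv, h⟩ else False).card = (univ.filter P).card := by
  rw [Finset.card_filter, Finset.card_filter, Finset.sum_range]
  refine Finset.sum_congr rfl fun wv _ => ?_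
  simp [wv.isLt]

/-- The validation sample read off a window assignment. [folklore] -/
def sampleOf {M n : ℕ} (w : Fin (M * n) → Bool) : Fin M → (Fin n → Bool) := fun wv d => w (finProdFinEquiv (wv, d))

/-- The sample map is the canonical equivalence `(Fin (M·n) → Bool) ≃ (Fin M → Fin n → Bool)`. [folklore] -/
def sampleEquiv (M n : ℕ) : (Fin (M * n) → Bool) ≃ (Fin M → Fin n → Bool) :=
  (Equiv.arrowCongr finProdFinEquiv.symm (Equiv.refl Bool)).trans (Equiv.curry _ _ _)

/-- Value of `sampleEquiv`. [folklore] -/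
theorem sampleEquiv_apply {M n : ℕ} (w : Fin (M * n) → Bool) : sampleEquiv M n w = sampleOf w := by
  funext wv d
  simp [sampleEquiv, sampleOf, Equiv.arrowCongr, Equiv.curry]

/-- The index of sample point `wv`, coordinate `d`. [folklore] -/
theorem finProdFinEquiv_eq_mk {M n : ℕ} (wv : Fin M) (d : Fin n) (h : (wv : ℕ) * n + d < M * n) :
    finProdFinEquiv (wv, d) = ⟨wv * n + d, h⟩ :=
  Fin.ext (by rw [finProdFinEquiv_apply_val]; exact (by ring : (d : ℕ) + n * wv = wv * n + d))

/-- The number of sample points a fixed hypothesis gets wrong. [folklore] -/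
def sampleErrs (f h : (Fin n → Bool) → Bool) {M : ℕ} (ω : Fin M → (Fin n → Bool)) : ℕ :=
  (univ.filter fun wv => h (ω wv) ≠ f (ω wv)).card

/-- **Hoeffding for the validation sample, lower tail**: if `err(h) > 2ⁿ/a`, few samples show
`≤ 3m/(4a)` errors. [cite: Hoeffding1963, Thm. 1] -/
theorem card_sample_passes_le (ha : 1 ≤ a) {M : ℕ} (hM : 0 < M) (h : (Fin n → Bool) → Bool)
    (herr : 2 ^ n < a * errCount n f h) :
    ((univ.filter fun ω : Fin M → (Fin n → Bool) => 4 * a * sampleErrs f h ω ≤ 3 * M).card : ℝ) ≤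
      Real.exp (-2 * M * (1 / (4 * a)) ^ 2) * 2 ^ (n * M) := by
  classical
  have ha' : (0 : ℝ) < a := by exact_mod_cast ha
  set F : (Fin n → Bool) → ℝ := fun x => if h x ≠ f x then 1 else 0 with hF
  have hFb : ∀ x, F x ∈ Set.Icc (0 : ℝ) 1 := fun x => by simp only [hF]; split_ifs <;> norm_num
  have hH := card_lowerDeviation_sum_on_le_exp (ι := Fin M) (α := Fin n → Bool) univ (by simpa using hM) F hFb
    (η := 1 / (4 * a)) (by positivity)
  simp only [Finset.card_univ, Fintype.card_fin, Fintype.card_fun, Fintype.card_bool, Nat.cast_pow, Nat.cast_ofNat] at hH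
  have hS : ∀ ω : Fin M → (Fin n → Bool), ∑ i, F (ω i) = (sampleErrs f h ω : ℝ) := fun ω => by
    rw [sampleErrs, Finset.natCast_card_filter]
  have hE : ∑ x, F x = (errCount n f h : ℝ) := by rw [errCount, Finset.natCast_card_filter]
  refine le_trans (Nat.cast_le.2 (Finset.card_le_card fun ω hω => ?_)) (hH.trans (le_of_eq (by rw [pow_mul])))
  simp only [Finset.mem_filter, Finset.mem_univ, true_and] at hω ⊢
  rw [hS, hE]
  have h1 : (4 * a * sampleErrs f h ω : ℝ) ≤ 3 * M := by exact_mod_cast hω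
  have h2 : (2 ^ n : ℝ) < a * errCount n f h := by exact_mod_cast herr
  have h2n : (0 : ℝ) < 2 ^ n := by positivity
  have hM0 : (0 : ℝ) < M := by exact_mod_cast hM
  -- `S ≤ 3M/(4a) < M·err/2ⁿ - M/(4a)`
  have h3 : (1 : ℝ) / a < errCount n f h / 2 ^ n := by
    rw [div_lt_div_iff₀ ha' h2n]; linarith
  have h4 : (sampleErrs f h ω : ℝ) ≤ 3 * M / (4 * a) := by
    rw [le_div_iff₀ (by positivity)]; linarith
  have h5 : (3 : ℝ) * M / (4 * a) = M * (1 / a) - M * (1 / (4 * a)) := by field_simp; ring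
  rw [h5] at h4
  have h6 : (M : ℝ) * (1 / a) ≤ M * (errCount n f h / 2 ^ n) := mul_le_mul_of_nonneg_left h3.le hM0.le
  linarith

/-- **Hoeffding for the validation sample, upper tail**: if `err(h) ≤ 2ⁿ/(2a)`, few samples show
`> 3m/(4a)` errors. [cite: Hoeffding1963, Thm. 1] -/
theorem card_sample_fails_le (ha : 1 ≤ a) {M : ℕ} (hM : 0 < M) (h : (Fin n → Bool) → Bool)
    (herr : 2 * a * errCount n f h ≤ 2 ^ n) :
    ((univ.filter fun ω : Fin M → (Fin n → Bool) => 3 * M < 4 * a * sampleErrs f h ω).card : ℝ) ≤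
      Real.exp (-2 * M * (1 / (4 * a)) ^ 2) * 2 ^ (n * M) := by
  classical
  have ha' : (0 : ℝ) < a := by exact_mod_cast ha
  set F : (Fin n → Bool) → ℝ := fun x => if h x ≠ f x then 1 else 0 with hF
  have hFb : ∀ x, F x ∈ Set.Icc (0 : ℝ) 1 := fun x => by simp only [hF]; split_ifs <;> norm_num
  have hH := card_upperDeviation_sum_on_le_exp (ι := Fin M) (α := Fin n → Bool) univ (by simpa using hM) F hFb
    (η := 1 / (4 * a)) (by positivity)
  simp only [Finset.card_univ, Fintype.card_fin, Fintype.card_fun, Fintype.card_bool, Nat.cast_pow, Nat.cast_ofNat] at hH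
  have hS : ∀ ω : Fin M → (Fin n → Bool), ∑ i, F (ω i) = (sampleErrs f h ω : ℝ) := fun ω => by
    rw [sampleErrs, Finset.natCast_card_filter]
  have hE : ∑ x, F x = (errCount n f h : ℝ) := by rw [errCount, Finset.natCast_card_filter]
  refine le_trans (Nat.cast_le.2 (Finset.card_le_card fun ω hω => ?_)) (hH.trans (le_of_eq (by rw [pow_mul])))
  simp only [Finset.mem_filter, Finset.mem_univ, true_and] at hω ⊢
  rw [hS, hE]
  have h1 : (3 * M : ℝ) < 4 * a * sampleErrs f h ω := by exact_mod_cast hω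
  have h2 : (2 * a * errCount n f h : ℝ) ≤ 2 ^ n := by exact_mod_cast herr
  have h2n : (0 : ℝ) < 2 ^ n := by positivity
  have hM0 : (0 : ℝ) < M := by exact_mod_cast hM
  have h3 : (errCount n f h : ℝ) / 2 ^ n ≤ 1 / (2 * a) := by
    rw [div_le_div_iff₀ h2n (by positivity)]; linarith
  have h4 : (3 : ℝ) * M / (4 * a) < sampleErrs f h ω := by
    rw [div_lt_iff₀ (by positivity)]; linarith
  have h5 : (3 : ℝ) * M / (4 * a) = M * (1 / (2 * a)) + M * (1 / (4 * a)) := by field_simp; ring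
  rw [h5] at h4
  have h6 : (M : ℝ) * (errCount n f h / 2 ^ n) ≤ M * (1 / (2 * a)) := mul_le_mul_of_nonneg_left h3 hM0.le
  linarith

/-- **A misleading validation is rare**: `#{rv | BadV ℓ ρ rv} ≤ 2 e^{-2m(1/4a)²} · 2^{coinLen}`
(`ℓ ≤ ℓg`, `ρ < Reps ℓ`, `a ≥ 1`, `m ≥ 1`). [cite: CarmosinoImpagliazzoKabanetsKolokolova2016, Thm. 5.1 (proof: validation by Chernoff–Hoeffding)] -/
theorem card_badV_le (ha : 1 ≤ a) {ℓ : ℕ} (hℓ : ℓ ≤ ℓg) {ρ : ℕ} (hρ : ρ < prmReps (prmS n a b) ℓ) (hM : 0 < prmM (prmS n a b) ℓ) :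
    ((univ.filter (BadV n a b f R ℓg ℓ ρ)).card : ℝ) ≤
      2 * Real.exp (-2 * prmM (prmS n a b) ℓ * (1 / (4 * a)) ^ 2) * 2 ^ coinLen n a b ℓg := by
  have hV := valWindow_le (n := n) (a := a) (b := b) hℓ
  have hsegW := segWindow_le (n := n) (a := a) (b := b) hℓ hρ
  set M := prmM (prmS n a b) ℓ with hMdef
  -- the run window lies before the validation window
  have hdis : lvlCoff n a b ℓ + ρ * lvlRunLen n a b ℓ + lvlRunLen n a b ℓ ≤ lvlCoff n a b ℓ + prmReps (prmS n a b) ℓ * lvlRunLen n a b ℓ := by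
    have : (ρ + 1) * lvlRunLen n a b ℓ ≤ prmReps (prmS n a b) ℓ * lvlRunLen n a b ℓ := Nat.mul_le_mul_right _ hρ
    rw [Nat.succ_mul] at this; omega
  -- fibre bound
  have hfib : ∀ rest : Fin (coinLen n a b ℓg - M * n) → Bool,
      ((univ.filter fun w : Fin (M * n) → Bool => BadV n a b f R ℓg ℓ ρ (glue hV (rest, w))).card : ℝ) ≤
        2 * Real.exp (-2 * M * (1 / (4 * a)) ^ 2) * 2 ^ (n * M) := by
    intro rest
    set h₀ := hypOf R n a b (coinsList n a b ℓg (glue hV (rest, fun _ => false))) f ℓ ρ with hh₀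
    have hind : ∀ w, hypOf R n a b (coinsList n a b ℓg (glue hV (rest, w))) f ℓ ρ = h₀ := by
      intro w
      rw [hh₀, hypOf_eq_runHypW hℓ hρ, hypOf_eq_runHypW hℓ hρ, windowRead_glue_of_disjoint hV hsegW (Or.inl hdis)]
    have herrs : ∀ w, errsOf R n a b (coinsList n a b ℓg (glue hV (rest, w))) f ℓ ρ = sampleErrs f h₀ (sampleOf w) := by
      intro w
      rw [errsOf_eq hℓ ρ, hind w, sampleErrs, ← card_filter_range_dite]
      refine congrArg Finset.card (Finset.filter_congr fun wv hwv => ?_)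
      rw [Finset.mem_range] at hwv
      rw [dif_pos hwv, dif_pos hwv]
      have hpt : (fun d : Fin n => windowRead hV (glue hV (rest, w)) ⟨wv * n + d, by
          have : (wv + 1) * n ≤ M * n := Nat.mul_le_mul_right _ hwv
          rw [Nat.succ_mul] at this; omega⟩) = sampleOf w ⟨wv, hwv⟩ := by
        funext d
        rw [windowRead_glue, sampleOf, finProdFinEquiv_eq_mk]
      rw [hpt]
    -- the fibre is contained in the two Hoeffding tails
    have hsub : (univ.filter fun w : Fin (M * n) → Bool => BadV n a b f R ℓg ℓ ρ (glue hV (rest, w))) ⊆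
        (univ.filter fun w => 2 ^ n < a * errCount n f h₀ ∧ 4 * a * sampleErrs f h₀ (sampleOf w) ≤ 3 * M) ∪
        (univ.filter fun w => 2 * a * errCount n f h₀ ≤ 2 ^ n ∧ 3 * M < 4 * a * sampleErrs f h₀ (sampleOf w)) := by
      intro w hw
      simp only [Finset.mem_filter, Finset.mem_univ, true_and, Finset.mem_union] at hw ⊢
      simp only [BadV, GoodRun, hind w, Passes, herrs w] at hw
      rcases hw with ⟨h1, h2⟩ | ⟨h1, h2⟩
      · exact Or.inl ⟨h1, h2⟩
      · exact Or.inr ⟨h1, not_le.1 h2⟩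
    have htail : ∀ (Q : (Fin M → (Fin n → Bool)) → Prop) [DecidablePred Q],
        (univ.filter fun w : Fin (M * n) → Bool => Q (sampleOf w)).card = (univ.filter Q).card := by
      intro Q _
      rw [← card_filter_univ_equiv (sampleEquiv M n) Q]
      refine congrArg Finset.card (Finset.filter_congr fun w _ => by rw [sampleEquiv_apply])
    refine le_trans (Nat.cast_le.2 ((Finset.card_le_card hsub).trans (Finset.card_union_le _ _))) ?_
    push_cast
    have hexp : 0 ≤ Real.exp (-2 * M * (1 / (4 * a)) ^ 2) * 2 ^ (n * M) := by positivity
    have t1 : ((univ.filter fun w : Fin (M * n) → Bool => 2 ^ n < a * errCount n f h₀ ∧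
        4 * a * sampleErrs f h₀ (sampleOf w) ≤ 3 * M).card : ℝ) ≤ Real.exp (-2 * M * (1 / (4 * a)) ^ 2) * 2 ^ (n * M) := by
      by_cases hc : 2 ^ n < a * errCount n f h₀
      · rw [Finset.filter_congr (q := fun w => 4 * a * sampleErrs f h₀ (sampleOf w) ≤ 3 * M) (fun w _ => by simp [hc]),
          htail (fun ω => 4 * a * sampleErrs f h₀ ω ≤ 3 * M)]
        exact card_sample_passes_le ha hM h₀ hc
      · rw [Finset.filter_false_of_mem (fun w _ => by simp [hc]), Finset.card_empty, Nat.cast_zero]; exact hexp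
    have t2 : ((univ.filter fun w : Fin (M * n) → Bool => 2 * a * errCount n f h₀ ≤ 2 ^ n ∧
        3 * M < 4 * a * sampleErrs f h₀ (sampleOf w)).card : ℝ) ≤ Real.exp (-2 * M * (1 / (4 * a)) ^ 2) * 2 ^ (n * M) := by
      by_cases hc : 2 * a * errCount n f h₀ ≤ 2 ^ n
      · rw [Finset.filter_congr (q := fun w => 3 * M < 4 * a * sampleErrs f h₀ (sampleOf w)) (fun w _ => by simp [hc]),
          htail (fun ω => 3 * M < 4 * a * sampleErrs f h₀ ω)]
        exact card_sample_fails_le ha hM h₀ hc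
      · rw [Finset.filter_false_of_mem (fun w _ => by simp [hc]), Finset.card_empty, Nat.cast_zero]; exact hexp
    linarith
  have := card_filter_window_le hV (BadV n a b f R ℓg ℓ ρ) hfib
  refine this.trans (le_of_eq ?_)
  have hC : n * M + (coinLen n a b ℓg - M * n) = coinLen n a b ℓg := by
    rw [mul_comm]; exact Nat.add_sub_cancel' (le_trans (Nat.le_add_left _ _) hV)
  rw [mul_assoc (2 * Real.exp _), ← pow_add, hC]

end Validation

/-! ### The union bound -/

section Union

variable {n a b : ℕ} {f : (Fin n → Bool) → Bool} {R : CombinatorialProperty} {ℓg : ℕ}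

/-- **Failure is covered by "no good run" and the misleading validations.** [folklore] -/
theorem not_success_subset :
    (univ.filter fun rv => ¬ Success n a b f R ℓg rv) ⊆
      (univ.filter (NoGoodBelow n a b f R ℓg (prmReps (prmS n a b) ℓg))) ∪
        (Finset.range (ℓg + 1)).biUnion fun ℓ => (Finset.range (prmReps (prmS n a b) ℓ)).biUnion fun ρ =>
          univ.filter (BadV n a b f R ℓg ℓ ρ) := by
  intro rv hrv
  simp only [Finset.mem_filter, Finset.mem_univ, true_and] at hrv
  simp only [Finset.mem_union, Finset.mem_filter, Finset.mem_univ, true_and, Finset.mem_biUnion, Finset.mem_range]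
  by_contra hc
  rw [not_or, not_exists] at hc
  obtain ⟨h1, h2⟩ := hc
  apply hrv
  refine success_of rv ?_ fun ℓ hℓ ρ hρ hbad => h2 ℓ ⟨Nat.lt_succ_of_le hℓ, ρ, hρ, hbad⟩
  rw [NoGoodBelow] at h1
  simp only [not_forall, not_not, exists_prop] at h1
  exact h1

/-- **The failure count of the learner** (over uniform coins of length `coinLen ℓg`):
`#{¬Success} ≤ ((1-p₀)^{Reps(ℓg)} + Σ_{ℓ ≤ ℓg} Reps(ℓ)·2e^{-2m(ℓ)/(16a²)})·2^{coinLen}`.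
[cite: CarmosinoImpagliazzoKabanetsKolokolova2016, Thm. 5.1 (proof)] -/
theorem card_not_success_le (ha : 1 ≤ a) (hM : ∀ ℓ, 0 < prmM (prmS n a b) ℓ) {p₀ : ℝ}
    (hp : p₀ * 2 ^ lvlRunLen n a b ℓg ≤ ((univ.filter (GoodW n a b f R ℓg)).card : ℝ)) :
    ((univ.filter fun rv => ¬ Success n a b f R ℓg rv).card : ℝ) ≤
      ((1 - p₀) ^ prmReps (prmS n a b) ℓg +
        ∑ ℓ ∈ Finset.range (ℓg + 1), prmReps (prmS n a b) ℓ * (2 * Real.exp (-2 * prmM (prmS n a b) ℓ * (1 / (4 * a)) ^ 2))) *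
        2 ^ coinLen n a b ℓg := by
  have h1 := card_noGood_le (f := f) (R := R) hp
  have hsub := not_success_subset (n := n) (a := a) (b := b) (f := f) (R := R) (ℓg := ℓg)
  have hcard := (Finset.card_le_card hsub).trans (Finset.card_union_le _ _)
  have hbi : ((Finset.range (ℓg + 1)).biUnion fun ℓ => (Finset.range (prmReps (prmS n a b) ℓ)).biUnion fun ρ =>
      univ.filter (BadV n a b f R ℓg ℓ ρ)).card ≤
      ∑ ℓ ∈ Finset.range (ℓg + 1), ∑ ρ ∈ Finset.range (prmReps (prmS n a b) ℓ), (univ.filter (BadV n a b f R ℓg ℓ ρ)).card :=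
    Finset.card_biUnion_le.trans (Finset.sum_le_sum fun ℓ _ => Finset.card_biUnion_le)
  have hsum : (∑ ℓ ∈ Finset.range (ℓg + 1), ∑ ρ ∈ Finset.range (prmReps (prmS n a b) ℓ),
      ((univ.filter (BadV n a b f R ℓg ℓ ρ)).card : ℝ)) ≤
      ∑ ℓ ∈ Finset.range (ℓg + 1), prmReps (prmS n a b) ℓ * (2 * Real.exp (-2 * prmM (prmS n a b) ℓ * (1 / (4 * a)) ^ 2)) *
        2 ^ coinLen n a b ℓg := by
    refine Finset.sum_le_sum fun ℓ hℓ => ?_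
    rw [Finset.mem_range] at hℓ
    calc ∑ ρ ∈ Finset.range (prmReps (prmS n a b) ℓ), ((univ.filter (BadV n a b f R ℓg ℓ ρ)).card : ℝ)
        ≤ ∑ _ρ ∈ Finset.range (prmReps (prmS n a b) ℓ), 2 * Real.exp (-2 * prmM (prmS n a b) ℓ * (1 / (4 * a)) ^ 2) * 2 ^ coinLen n a b ℓg :=
          Finset.sum_le_sum fun ρ hρ => card_badV_le ha (Nat.le_of_lt_succ hℓ) (Finset.mem_range.1 hρ) (hM ℓ)
      _ = prmReps (prmS n a b) ℓ * (2 * Real.exp (-2 * prmM (prmS n a b) ℓ * (1 / (4 * a)) ^ 2)) * 2 ^ coinLen n a b ℓg := by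
          rw [Finset.sum_const, Finset.card_range, nsmul_eq_mul]; ring
  have hcardR : ((univ.filter fun rv => ¬ Success n a b f R ℓg rv).card : ℝ) ≤
      ((univ.filter (NoGoodBelow n a b f R ℓg (prmReps (prmS n a b) ℓg))).card : ℝ) +
      ∑ ℓ ∈ Finset.range (ℓg + 1), ∑ ρ ∈ Finset.range (prmReps (prmS n a b) ℓ), ((univ.filter (BadV n a b f R ℓg ℓ ρ)).card : ℝ) := by
    have := hcard.trans (Nat.add_le_add_left hbi _)
    exact_mod_cast this
  rw [add_mul, Finset.sum_mul]
  linarith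

end Union




end Literature.Computability.Learning
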